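import Mathlib

/-!
# wall_bubbling — (M) instrument, typed by-product: the exponential Newton inequalities (ENS) — STATEMENT FILE

Crux `DoorA26` (stmt-ValiantsHypothesis-19979), line `Cruxes/DoorA26/Lines/wall_bubbling.lean`, obligation (M)
`Stmt.stub_mixedWalls`.  The second-order sieve of `Lines/wall_bubbling_M-sieve.md` (§2.4, items E1/E2) uses the
following fact about REAL exponential sums, which its author did not find in print for real exponents (nearest:
Newton's inequalities for real-rooted polynomials, to which it specialises exactly at integer exponents, and the
Descartes–Laguerre rule of signs for exponential sums [braess1986 VI.1.2]):

**ENS.** Let `g(t) = Σ_{m<n} a_m e^{v_m t}` with `v_0 < … < v_{n-1}` and all `a_m ≠ 0`.  If `g` has `n-1` distinct real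
zeros (the Descartes maximum), then the points `(v_m, c_m)`, `c_m = log(|a_m| · Π_{k≠m} |v_m − v_k|)`, are in (weakly)
concave position.

Proof sketch (paper, memo §2.4): induct on `n` with Rolle applied to `e^{-v_0 t} g`, whose derivative is an `(n-1)`-term
sum with coefficients `a_m (v_m − v_0)` and `n-2` interlacing zeros; the differentiation factors accumulate to
`Π_{k≠m}|v_m − v_k|`; the base case `n = 3` is the weighted AM–GM midpoint inequality for a 3-term sum with 2 zeros.
The sieve applies ENS to LIMIT functions of clusters, where zeros may merge; the weak inequality passes to such limits by
continuity of `c_m` in `(v, a)` on the locus `a_m ≠ 0`, `v` injective — so the distinct-zeros form below is the one to prove.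

STATUS: statement only, proof `sorry` (crux-directory workfile; critic val-idea-crit-5 g2 VERDICT #2 P4″ asked for the
typed statement before certificates cite it).  Nothing here is a route item; no summit statement is touched.
-/

namespace Summit.ValiantsHypothesis.ValiantsHypothesis.Cruxes.DoorA26.WallBubbling.ENS

open Finset

/-- The real exponential sum `t ↦ Σ_m a_m · exp(v_m · t)`. -/
noncomputable def expSum {n : ℕ} (v a : Fin n → ℝ) (t : ℝ) : ℝ :=
  ∑ m, a m * Real.exp (v m * t)

/-- The ENS weight `c_m = log(|a_m| · Π_{k ≠ m} |v_m − v_k|)`. -/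
noncomputable def weight {n : ℕ} (v a : Fin n → ℝ) (m : Fin n) : ℝ :=
  Real.log (|a m| * ∏ k ∈ univ.erase m, |v m - v k|)

/-- ENS, distinct-zeros / weak form: `n-1` distinct real zeros force the weights into concave position
with respect to the exponents: for `i < j < k`,
`(v_k − v_i)·c_j ≥ (v_k − v_j)·c_i + (v_j − v_i)·c_k`. -/
def Stmt.ens : Prop :=
  ∀ (n : ℕ) (v a : Fin n → ℝ), StrictMono v → (∀ m, a m ≠ 0) →
    (∃ z : Fin (n - 1) → ℝ, Function.Injective z ∧ ∀ i, expSum v a (z i) = 0) →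
    ∀ i j k : Fin n, i < j → j < k →
      (v k - v j) * weight v a i + (v j - v i) * weight v a k ≤ (v k - v i) * weight v a j

/-- ENS (exponential Newton inequalities).  Proof: Rolle induction, see the module docstring; not yet formalised. -/
theorem ens : Stmt.ens := by
  sorry

/-- Sanity instance of the inequality's ARITHMETIC at integer exponents (no content about `Stmt.ens` itself):
`x² − 3x + 2 = (x−1)(x−2)` ↔ `a = (2, −3, 1)` at `v = (0, 1, 2)` has the two zeros `t = log 1, log 2`; the weights are
`log(2·2), log(3·1), log(1·2)` and ENS reads `log 4 + log 2 ≤ 2·log 3`, i.e. Newton's inequality `a₁² ≥ 4·a₀a₂·(1/4)·…`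
in its sharp integer form `9 ≥ 8`. -/
example : Real.log 4 + Real.log 2 ≤ 2 * Real.log 3 := by
  rw [← Real.log_mul (by norm_num) (by norm_num), ← Real.log_rpow (by norm_num)]
  exact Real.log_le_log (by norm_num) (by norm_num)

end Summit.ValiantsHypothesis.ValiantsHypothesis.Cruxes.DoorA26.WallBubbling.ENS
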